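import Literature.MathematicalPhysics.QuantumFieldTheory.ItoTheoremSU2
import Literature.Analysis.SpecialFunctions.PerturbedChebyshevRecurrence
import HarnessLib

/-!
# Tomboulis 2007: positivity of the decimated coefficients (2.28), Prop. V.1 by telescoping, and Prop. V.2 —
# the uncontested links of the chain «(5.16) ⟹ confinement» as theorems

E. T. Tomboulis, *Confinement for all values of the coupling in four-dimensional SU(2) gauge theory*,
arXiv:0707.2179v1 (2007) [Tomboulis2007Confinement].  The file of record
`TomboulisConfinementClaim.lean` types the paper's claimed theorem as the implication `ConfinementFromIneq516`
whose seven hypotheses (H_pos), (H_flow), (H_sc), (H_C), (H_V1), (H_V2), (H_516) are NAMED, and proves the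
implication itself (`ConfinementFromIneq516_holds`).  Two of the named hypotheses are steps that Ito–Seiler
(arXiv:0711.4930, 0803.3019, 0901.4246) do NOT contest and that the file of record describes as "elementary …
recorded as a `Prop`, not proved here": Prop. V.1 as an implication (`PropV1Claim`, telescoping) and Prop. V.2 as an
implication (`PropV2Claim`, (5.21)).  This file PROVES them in the kernel, following the printed argument, together
with the §2.2 positivity statement (2.28) they rest on, so that what remains named in the chain is exactly the
contested content.  Theorems only; no definition, no named fact.

## Main statements (namespace `Literature.MathematicalPhysics.QuantumFieldTheory.Tomboulis2007`)

* `chebyshevU_natCast_mul`, `su2Char_mul_su2Char` — the Clebsch–Gordan ("KG") reduction rule (2.29)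
  `χ_i χ_j = Σ_{k=|i-j|}^{i+j} χ_k` as the Chebyshev linearisation `U_m U_n = Σ_{k=0}^{m} U_{n-m+2k}`;
  `integral_su2Char_mul_su2Char` — character orthonormality, derived from (2.29) and `∫ χ_n dU = δ_{n0}`
  (`ItoSU2.integral_su2Char_eq_zero`); `exists_plaqFn_pow_eq_charSum` — for integer `ζ` and `c_j ≥ 0`, `f_c^ζ` is a
  character sum with NON-NEGATIVE coefficients and trivial coefficient `≥ 1` ("positivity of the Fourier coefficients
  … is maintained", §2.2).
* **(2.28) as printed**, `F_0(n) ≥ 1`, `1 ≥ c_j(n) ≥ 0` for integer `ζ`: `mkFhat_nonneg` (`F̂_j ≥ 0`, (2.22)),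
  `one_le_mkFhat_zero`, `one_le_mkF0` (`F_0 = F̂_0^{b²} ≥ 1`), `mkCoeff_nonneg` (`c_j(n) ≥ 0`, every real `r`), and on
  the positivity domain `f_c ≥ 0`: `mkFhat_le_mkFhat_zero_of_nonneg`, `mkCoeff_le_one_of_nonneg`,
  `coeffAdmissible_mkCoeff_of_nonneg` (`c_j(n) ≤ 1`, every `r ≥ 0`).  Along the upper-bound column of scheme (3.38):
  `upperCoeffIter_nonneg`, `one_le_upperF0Iter`, `upperF0Iter_pos` (every `r`).
* **Prop. V.1 (5.17)–(5.18) PROVED** — `propV1Claim_of_nonneg`, `propV1Claim_of_admissible`: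
  `PropV1Claim d L b J n r hij c` for every `n ≥ 1` whenever `c_j ≥ 0` (`j ≠ 0`), a fortiori on the admissible domain
  (2.8); all `d`, `L`, `b`, `J`, `r`, planes.  Printed proof ((5.10)–(5.13)): the fixing equations (3.24)/(4.19) of
  the two columns telescope (`ExactRepresentation.torusZ_eq_prod_mul_levelZ`, `…torusZplus_eq_prod_mul_levelZplus`),
  the bulk exponents agree level by level by the matching (5.9) and the common parameter (5.14)
  (`ExactRepresentation.interpH_eq`), the common product of bulk factors is positive by (2.28), and cancels in
  `Z⁺_Λ/Z_Λ`, hence in `Z⁻_Λ/Z_Λ`.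
* **Prop. V.2, lower half (5.22)** — `mktIneq_of_commonInterpolationIter_of_antitone`: V.1's conclusion and the
  monotonicity (5.24) of the level-`n` ratio give the MKT inequality (derivative-free, unconditional);
  `vortexRatioAntitone_of_ineq515_of_pos`: the typed (5.16) (`Ineq515`, `∂_α ln Z⁻ ≤ ∂_α ln Z` on `(0,1)`) implies
  (5.24) in integrated form GIVEN positivity of `Z` and `Z⁻` along the ray on `(0,1]` (polynomiality of
  `α ↦ Z({αc})`, `α ↦ Z⁻({αc})` — `exists_polynomial_torusZ_scaleCoeff`, `exists_polynomial_torusZtw_scaleCoeff` — and the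
  mean value theorem); `propV2Claim_of_pos`: (H_V2) `PropV2Claim` holds under that positivity proviso.
* **The assembled chain** — `electricFluxAreaLawAlong_of_chain`: `ConfinementFromIneq516` with (H_V1) no longer a
  hypothesis ((H_pos) at level `0` supplies `c_j ≥ 0`); `electricFluxAreaLawAlong_of_chain_of_pos`: moreover (H_V2)
  replaced by the positivity of the level-`n` partition functions `Z`, `Z⁻` along the rays.

## On the positivity proviso of V.2

The printed (5.16)/(5.21) take logarithms of `Z_{Λ^{(n)}}` and `Z⁻_{Λ^{(n)}}` along the ray; Tomboulis asserts their
positivity separately ((2.14) `Z > 1`; (5.3) "`1 < 1 + Z⁻/Z` … by IV.1" — IV.1 is the upper bound only, and the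
census side of the tree records that the lower bound is weak, `Z⁻ ≥ 0`, by reflection positivity in `d ≥ 3` and fails
in `d = 2`).  The typed `Ineq515` has no such guard (its `Real.log`/`deriv` take junk values where a partition
function vanishes), so (H_V2) is proved here exactly on the domain where the printed statement is meaningful, and the
proviso is carried as an explicit hypothesis; nothing about it is asserted.

## Deliberately NOT here

* Propagation of `f ≥ 0` (hence of `c_j(n) ≤ 1`, (H_pos)) along the column: at `r = 1` it follows from the
  convolution structure of (2.19) (`f_{ĉ^{b²}} = f_ĉ^{∗b²}`), which needs the character convolution identity
  `∫ χ_m(UV⁻¹)χ_n(V) dV = δ_{mn} χ_n(U)/d_n`, not available on the Literature side of the tree; for `r < 1` it is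
  Tomboulis's unproved "easily seen" (§3.1).  One step is `coeffAdmissible_mkCoeff_of_nonneg`.
* The contested links (H_C) (App. C; Ito–Seiler 2008 Problems 1–3, Kanazawa's counterexample) and (H_516) ((5.16);
  Ito–Seiler 2007 §3 "not proven"), the flow (H_flow) for `r < 1` (at `r = 1` and Wilson's action:
  `itoTheoremSU2_holds`), the strong-coupling input (H_sc) (§6.2): untouched, nothing asserted.
* Appendix D's quantitative bound (D.4) `F̂_0 ≥ 1 + ½ζ(ζ-1)Σ d_j²c_j²` and Prop. II.2 (2.31): not needed here.
* No new definition: character sums are written as explicit `Finset` sums and the coefficient families of `f_c^ζ`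
  are produced existentially (`exists_plaqFn_pow_eq_charSum`), so that the file stays on the proof lane.

Port note: `chebyshevU_natCast_mul`, `mkFhat_nonneg`, `one_le_mkFhat_zero`, `mkFhat_zero_pos`, `one_le_mkF0` restate,
with the same proofs, lemmas of the cell's Summits-side census module `Summit.Ventures.YMGap.Census.CharacterPowerExpansion`
(there over the `LatticeQCDFlow` character-series vocabulary), which a Literature file may not import (CONVENTIONS §2);
they are re-derived here so that the Literature file of record can use them.

## References
* E. T. Tomboulis, arXiv:0707.2179v1 (2007), §2.2 eqs. (2.19)–(2.22), (2.28)–(2.29); §3.2 (3.19)–(3.24); §3.4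
  scheme (3.38); §4.2 (4.15)–(4.19); §5.1 eqs. (5.9)–(5.14), Prop. V.1 (5.17)–(5.18); §5.2 (5.21)–(5.24),
  Prop. V.2 (5.22). [Tomboulis2007Confinement]  (Equation numbers of v1, checked against the cell's concordance
  `pub-ymgap/lit/LIT2-T07-EQUATION-CONCORDANCE.md`.)
* K. R. Ito, E. Seiler, arXiv:0711.4930 §3; arXiv:0803.3019 §3.2; PoS Confinement8 (2008) 034 = arXiv:0901.4246
  §§2, 4(b), 5 (which links are contested). [ItoSeiler2007Tomboulis] [ItoSeiler2008Further] [ItoSeiler2009Critical]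
* T. Bröcker, T. tom Dieck, *Representations of Compact Lie Groups* (1985), II (4.11), §5 (characters of `SU(2)`,
  orthogonality) — via `ItoTheoremSU2.lean`. [BrockerTomDieck1985]
-/

noncomputable section

open MeasureTheory Finset Real Filter Polynomial
open scoped BigOperators Topology

namespace Literature.MathematicalPhysics.QuantumFieldTheory

namespace Tomboulis2007

open Literature.MathematicalPhysics.QuantumLattice
open MullerSchiemann1987.HeatKernel (u0 abs_u0_le_one trace_re_div_two continuous_u0)

/-! ### §2.2 (2.29): the Clebsch–Gordan rule for the `SU(2)` characters (Chebyshev linearisation) -/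

section Chebyshev

open Polynomial.Chebyshev

variable (R : Type*) [CommRing R]

/-- `2X · U_j = U_{j+1} + U_{j-1}` for every `j ∈ ℤ` (three-term recurrence). [folklore] -/
private theorem two_X_mul_U (j : ℤ) : 2 * X * U R j = U R (j + 1) + U R (j - 1) := by
  have h := U_add_one R j
  linear_combination -h

/-- **Chebyshev linearisation** `U_m · U_n = Σ_{k=0}^{m} U_{n-m+2k}` (`m ∈ ℕ`, `n ∈ ℤ`) — the polynomial form of
the Clebsch–Gordan rule `χ_i χ_j = Σ_{k=|i-j|}^{i+j} χ_k` of `SU(2)` (Tomboulis 2007 eq. (2.29), "the KG reduction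
rule"). [cite: Tomboulis2007Confinement, §2.2 eq. (2.29)] -/
theorem chebyshevU_natCast_mul (m : ℕ) :
    ∀ n : ℤ, U R (m : ℤ) * U R n = ∑ k ∈ Finset.range (m + 1), U R (n - m + 2 * k) := by
  induction m using Nat.twoStepInduction with
  | zero =>
    intro n
    simp
  | one =>
    intro n
    rw [Finset.sum_range_succ, Finset.sum_range_one]
    push_cast
    rw [U_one, two_X_mul_U, add_zero, show n - 1 + 2 = n + 1 by ring, add_comm]
  | more m ih0 ih1 =>
    intro n
    have hrec : U R ((m + 2 : ℕ) : ℤ) = 2 * X * U R ((m + 1 : ℕ) : ℤ) - U R (m : ℤ) := by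
      have := U_add_two R (m : ℤ)
      push_cast
      exact this
    rw [hrec, sub_mul, mul_assoc, ih1 n, ih0 n, Finset.mul_sum]
    simp_rw [two_X_mul_U]
    rw [Finset.sum_add_distrib]
    have hA : ∑ k ∈ Finset.range (m + 2), U R (n - ((m + 1 : ℕ) : ℤ) + 2 * k + 1) =
        ∑ k ∈ Finset.range (m + 1), U R (n - (m : ℤ) + 2 * k) + U R (n + m + 2) := by
      rw [Finset.sum_range_succ]
      congr 1
      · refine Finset.sum_congr rfl fun k _ => ?_
        congr 1
        push_cast
        ring
      · congr 1
        push_cast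
        ring
    have hB : ∑ k ∈ Finset.range (m + 2), U R (n - ((m + 1 : ℕ) : ℤ) + 2 * k - 1) =
        ∑ k ∈ Finset.range (m + 2), U R (n - ((m + 2 : ℕ) : ℤ) + 2 * k) := by
      refine Finset.sum_congr rfl fun k _ => ?_
      congr 1
      push_cast
      ring
    rw [hA, hB, Finset.sum_range_succ (fun k => U R (n - ((m + 2 : ℕ) : ℤ) + 2 * k)) (m + 2)]
    have hlast : U R (n - ((m + 2 : ℕ) : ℤ) + 2 * ((m + 2 : ℕ) : ℤ)) = U R (n + m + 2) := by
      congr 1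
      push_cast
      ring
    rw [hlast]
    ring

end Chebyshev

/-! ### Characters: evaluation, continuity, products -/

/-- `χ_0 = 1`. [folklore] -/
private theorem su2Char_zero (U : SU2) : su2Char 0 U = 1 := by
  simp [su2Char]

/-- The characters are continuous (plumbing). [folklore] -/
private theorem continuous_su2Char' (n : ℕ) : Continuous (su2Char n) := by
  have h : su2Char n = fun U => (Polynomial.Chebyshev.U ℝ (n : ℤ)).eval (u0 U) :=
    funext (ItoSU2.su2Char_eq_eval_u0 n)
  rw [h]
  exact (Polynomial.continuous _).comp continuous_u0

/-- Continuous real functions on `SU(2)` are Haar integrable (plumbing). [folklore] -/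
private theorem integrable_of_continuous_su2 {f : SU2 → ℝ} (hf : Continuous f) :
    Integrable f (haarProbability SU2) :=
  hf.integrable_of_hasCompactSupport (HasCompactSupport.of_compactSpace _)

/-- **The Clebsch–Gordan rule on the group**: `χ_i χ_j = Σ_{k=0}^{i} χ_{j-i+2k}` for `i ≤ j`
(Tomboulis 2007 (2.29)). [cite: Tomboulis2007Confinement, §2.2 eq. (2.29)] -/
theorem su2Char_mul_su2Char {i j : ℕ} (hij : i ≤ j) (U : SU2) :
    su2Char i U * su2Char j U = ∑ k ∈ Finset.range (i + 1), su2Char (j - i + 2 * k) U := by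
  unfold su2Char
  rw [← Polynomial.eval_mul, chebyshevU_natCast_mul, Polynomial.eval_finsetSum]
  refine Finset.sum_congr rfl fun k _ => ?_
  congr 2
  push_cast [Nat.cast_sub hij]
  ring

/-- `χ_i χ_j = Σ_{n ≤ N} N_{ij}^n χ_n` with the explicit `0/1` multiplicities
`N_{ij}^n = #{k ≤ min(i,j) : max − min + 2k = n}`, for any `N ≥ i + j` (plumbing form of (2.29)). [folklore] -/
private theorem su2Char_mul_eq_sum (i j N : ℕ) (hN : i + j ≤ N) (U : SU2) :
    su2Char i U * su2Char j U = ∑ n ∈ Finset.range (N + 1),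
      (∑ k ∈ Finset.range (min i j + 1), if max i j - min i j + 2 * k = n then (1 : ℝ) else 0) * su2Char n U := by
  have key : su2Char i U * su2Char j U =
      ∑ k ∈ Finset.range (min i j + 1), su2Char (max i j - min i j + 2 * k) U := by
    rcases le_total i j with h | h
    · rw [min_eq_left h, max_eq_right h, su2Char_mul_su2Char h]
    · rw [min_eq_right h, max_eq_left h, mul_comm, su2Char_mul_su2Char h]
  rw [key]
  simp_rw [Finset.sum_mul]
  rw [Finset.sum_comm]
  refine Finset.sum_congr rfl fun k hk => ?_
  simp_rw [ite_mul, one_mul, zero_mul]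
  rw [Finset.sum_ite_eq]
  have hk' := Finset.mem_range.1 hk
  refine (if_pos (Finset.mem_range.2 ?_)).symm
  rcases le_total i j with h | h
  · rw [min_eq_left h, max_eq_right h] at *; omega
  · rw [min_eq_right h, max_eq_left h] at *; omega

/-- **Products of non-negative character sums are non-negative character sums** whose trivial coefficient dominates the
product of the trivial coefficients (cut-offs add): the algebraic content of "positivity of the coefficients is
preserved … for integer ζ" (Tomboulis 2007 (2.28)–(2.29)). [cite: Tomboulis2007Confinement, §2.2 eqs. (2.28)–(2.29)] -/
theorem exists_charSum_mul (A B : ℕ) {a b : ℕ → ℝ} (ha : ∀ n, 0 ≤ a n) (hb : ∀ n, 0 ≤ b n) :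
    ∃ e : ℕ → ℝ, (∀ n, 0 ≤ e n) ∧ a 0 * b 0 ≤ e 0 ∧ ∀ U : SU2,
      (∑ n ∈ Finset.range (A + 1), a n * su2Char n U) * (∑ n ∈ Finset.range (B + 1), b n * su2Char n U) =
        ∑ n ∈ Finset.range (A + B + 1), e n * su2Char n U := by
  classical
  -- the Clebsch–Gordan multiplicities and the product coefficients
  let N : ℕ → ℕ → ℕ → ℝ := fun i j n =>
    ∑ k ∈ Finset.range (min i j + 1), if max i j - min i j + 2 * k = n then (1 : ℝ) else 0
  have hN : ∀ i j n, 0 ≤ N i j n := fun i j n =>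
    Finset.sum_nonneg fun k _ => by split_ifs <;> norm_num
  have hN0 : N 0 0 0 = 1 := by simp [N]
  let e : ℕ → ℝ := fun n => ∑ i ∈ Finset.range (A + 1), ∑ j ∈ Finset.range (B + 1), a i * b j * N i j n
  have hterm : ∀ i j n, 0 ≤ a i * b j * N i j n := fun i j n => mul_nonneg (mul_nonneg (ha i) (hb j)) (hN i j n)
  refine ⟨e, fun n => Finset.sum_nonneg fun i _ => Finset.sum_nonneg fun j _ => hterm i j n, ?_, fun U => ?_⟩
  · calc a 0 * b 0 = a 0 * b 0 * N 0 0 0 := by rw [hN0, mul_one]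
      _ ≤ ∑ j ∈ Finset.range (B + 1), a 0 * b j * N 0 j 0 :=
          Finset.single_le_sum (f := fun j => a 0 * b j * N 0 j 0) (fun j _ => hterm 0 j 0)
            (Finset.mem_range.2 (Nat.succ_pos B))
      _ ≤ e 0 :=
          Finset.single_le_sum (f := fun i => ∑ j ∈ Finset.range (B + 1), a i * b j * N i j 0)
            (fun i _ => Finset.sum_nonneg fun j _ => hterm i j 0) (Finset.mem_range.2 (Nat.succ_pos A))
  · rw [Finset.sum_mul_sum]
    have h1 : ∀ i ∈ Finset.range (A + 1), ∀ j ∈ Finset.range (B + 1),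
        a i * su2Char i U * (b j * su2Char j U) =
          ∑ n ∈ Finset.range (A + B + 1), a i * b j * N i j n * su2Char n U := by
      intro i hi j hj
      have hij : i + j ≤ A + B := by
        have := Finset.mem_range.1 hi; have := Finset.mem_range.1 hj; omega
      rw [show a i * su2Char i U * (b j * su2Char j U) = a i * b j * (su2Char i U * su2Char j U) by ring,
        su2Char_mul_eq_sum i j (A + B) hij U, Finset.mul_sum]
      refine Finset.sum_congr rfl fun n _ => ?_
      ring
    rw [Finset.sum_congr rfl (fun i hi => Finset.sum_congr rfl (fun j hj => h1 i hi j hj))]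
    have h3 : ∀ i ∈ Finset.range (A + 1),
        ∑ j ∈ Finset.range (B + 1), ∑ n ∈ Finset.range (A + B + 1), a i * b j * N i j n * su2Char n U =
        ∑ n ∈ Finset.range (A + B + 1), ∑ j ∈ Finset.range (B + 1), a i * b j * N i j n * su2Char n U :=
      fun i _ => Finset.sum_comm
    rw [Finset.sum_congr rfl h3, Finset.sum_comm]
    refine Finset.sum_congr rfl fun n _ => ?_
    rw [Finset.sum_mul]
    refine Finset.sum_congr rfl fun i _ => ?_
    rw [Finset.sum_mul]

/-- The plaquette function as a character sum with cut-off `J`: `f_c = Σ_{n ≤ J} a_n χ_n`, `a_0 = 1`,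
`a_n = d_j c_j = (n+1) c_n` (Tomboulis 2007 (2.5)–(2.6)). [cite: Tomboulis2007Confinement, §2 eqs. (2.5)–(2.6)] -/
theorem plaqFn_eq_charSum (J : ℕ) (c : ℕ → ℝ) (U : SU2) :
    plaqFn J c U = ∑ n ∈ Finset.range (J + 1),
      (if n = 0 then (1 : ℝ) else ((n : ℝ) + 1) * c n) * su2Char n U := by
  unfold plaqFn
  rw [Finset.range_eq_Ico, Finset.sum_eq_sum_Ico_succ_bot (Nat.succ_pos J), if_pos rfl, su2Char_zero, one_mul]
  congr 1
  rw [show Finset.Ico 1 (J + 1) = Finset.Icc 1 J from rfl]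
  refine Finset.sum_congr rfl fun n hn => ?_
  rw [if_neg (by have := (Finset.mem_Icc.1 hn).1; omega)]

/-- **The powers `f_c^ζ` are non-negative character sums with trivial coefficient `≥ 1`** when `c_j ≥ 0` (`j ≠ 0`),
for every integer `ζ` (cut-off `ζJ`) — Tomboulis 2007 (2.28)–(2.29): "for integer ζ the important property of
positivity of the Fourier coefficients … is maintained", by "repeated application of the KG reduction rule".
[cite: Tomboulis2007Confinement, §2.2 eqs. (2.28)–(2.29)] -/
theorem exists_plaqFn_pow_eq_charSum {J : ℕ} {c : ℕ → ℝ} (hc : ∀ n, 1 ≤ n → 0 ≤ c n) (ζ : ℕ) :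
    ∃ A : ℕ → ℝ, (∀ n, 0 ≤ A n) ∧ 1 ≤ A 0 ∧ ∀ U : SU2,
      plaqFn J c U ^ ζ = ∑ n ∈ Finset.range (ζ * J + 1), A n * su2Char n U := by
  classical
  have ha : ∀ n : ℕ, 0 ≤ (if n = 0 then (1 : ℝ) else ((n : ℝ) + 1) * c n) := fun n => by
    split_ifs with h
    · norm_num
    · exact mul_nonneg (by positivity) (hc n (by omega))
  induction ζ with
  | zero =>
    refine ⟨fun n => if n = 0 then 1 else 0, fun n => by dsimp only; split_ifs <;> norm_num, by simp, fun U => ?_⟩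
    simp [su2Char_zero]
  | succ ζ ih =>
    obtain ⟨A, hA, hA0, hAf⟩ := ih
    obtain ⟨e, he, he0, hef⟩ := exists_charSum_mul (ζ * J) J hA ha
    refine ⟨e, he, le_trans ?_ he0, fun U => ?_⟩
    · simp [hA0]
    · rw [pow_succ, hAf U, plaqFn_eq_charSum J c U, hef U, Nat.succ_mul]

/-! ### Character orthogonality from (2.29) and `∫ χ_n dU = δ_{n0}` -/

/-- `∫ χ_n dU = [n = 0]`. [folklore] -/
private theorem integral_su2Char (n : ℕ) :
    ∫ U, su2Char n U ∂(haarProbability SU2) = if n = 0 then 1 else 0 := by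
  split_ifs with h
  · subst h
    simp [su2Char_zero]
  · exact ItoSU2.integral_su2Char_eq_zero h

/-- `∫ Σ_{n ≤ K} a_n χ_n dU = a_0`: the Haar integral of a character sum is its trivial coefficient. [folklore] -/
private theorem integral_charSum (K : ℕ) (a : ℕ → ℝ) :
    ∫ U, ∑ n ∈ Finset.range (K + 1), a n * su2Char n U ∂(haarProbability SU2) = a 0 := by
  rw [integral_finsetSum _ (fun n _ => (integrable_of_continuous_su2 (continuous_su2Char' n)).const_mul (a n))]
  simp_rw [integral_const_mul, integral_su2Char, mul_ite, mul_one, mul_zero]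
  rw [Finset.sum_ite_eq']
  simp

/-- **Character orthonormality** `∫ χ_m χ_n dU = δ_{mn}` on `SU(2)`, here DERIVED from the Clebsch–Gordan rule (2.29)
and `∫ χ_n dU = δ_{n0}` ("character orthogonality", Tomboulis 2007 §2.2 after (2.29); Bröcker–tom Dieck II (4.11)).
[cite: Tomboulis2007Confinement, §2.2 eq. (2.29)] -/
theorem integral_su2Char_mul_su2Char (m n : ℕ) :
    ∫ U, su2Char m U * su2Char n U ∂(haarProbability SU2) = if m = n then 1 else 0 := by
  wlog hmn : m ≤ n generalizing m n
  · have h := this n m (not_le.mp hmn).le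
    simp_rw [mul_comm (su2Char m _)]
    rw [h]
    by_cases hnm : n = m
    · rw [if_pos hnm, if_pos hnm.symm]
    · rw [if_neg hnm, if_neg (Ne.symm hnm)]
  simp_rw [su2Char_mul_su2Char hmn]
  rw [integral_finsetSum _ (fun k _ => integrable_of_continuous_su2 (continuous_su2Char' _))]
  simp_rw [integral_su2Char]
  by_cases h : m = n
  · subst h
    rw [if_pos rfl, Finset.sum_eq_single 0 (fun k _ hk => if_neg (by omega)) (fun h0 => absurd (by simp) h0)]
    simp
  · rw [if_neg h]
    exact Finset.sum_eq_zero fun k _ => if_neg (by omega)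

/-- `∫ (Σ_{m ≤ K} a_m χ_m) χ_n dU = a_n [n ≤ K]`. [folklore] -/
private theorem integral_charSum_mul_su2Char (K : ℕ) (a : ℕ → ℝ) (n : ℕ) :
    ∫ U, (∑ m ∈ Finset.range (K + 1), a m * su2Char m U) * su2Char n U ∂(haarProbability SU2) =
      if n ≤ K then a n else 0 := by
  simp_rw [Finset.sum_mul]
  have hχ : ∀ m : ℕ, Integrable (fun U : SU2 => a m * su2Char m U * su2Char n U) (haarProbability SU2) :=
    fun m => integrable_of_continuous_su2
      ((continuous_const.mul (continuous_su2Char' m)).mul (continuous_su2Char' n))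
  rw [integral_finsetSum _ (fun m _ => hχ m)]
  simp_rw [mul_assoc, integral_const_mul, integral_su2Char_mul_su2Char, mul_ite, mul_one, mul_zero]
  rw [Finset.sum_ite_eq']
  by_cases h : n ≤ K
  · rw [if_pos (Finset.mem_range.2 (Nat.lt_succ_of_le h)), if_pos h]
  · rw [if_neg (fun hm => h (Nat.le_of_lt_succ (Finset.mem_range.1 hm))), if_neg h]

/-! ### §2.2 (2.28) AS PRINTED: `F̂_j ≥ 0`, `F_0 ≥ 1`, `c_j(n) ≥ 0` for integer `ζ` -/

/-- **Tomboulis 2007 (2.28), coefficient half: for integer `ζ` the character coefficients `F̂_j` (2.22) of `f_c^ζ`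
are non-negative** whenever `c_j ≥ 0` (`j ≠ 0`). [cite: Tomboulis2007Confinement, §2.2 eqs. (2.22), (2.28)] -/
theorem mkFhat_nonneg {J : ℕ} {c : ℕ → ℝ} (hc : ∀ n, 1 ≤ n → 0 ≤ c n) (ζ n : ℕ) :
    0 ≤ mkFhat J c ζ n := by
  obtain ⟨A, hA, -, hAf⟩ := exists_plaqFn_pow_eq_charSum hc ζ (J := J)
  unfold mkFhat
  have hpt : ∀ U : SU2, plaqFn J c U ^ ζ * (su2Char n U / ((n : ℝ) + 1)) =
      ((n : ℝ) + 1)⁻¹ * ((∑ m ∈ Finset.range (ζ * J + 1), A m * su2Char m U) * su2Char n U) := by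
    intro U; rw [hAf U]; ring
  simp_rw [hpt]
  rw [integral_const_mul, integral_charSum_mul_su2Char]
  split_ifs
  · exact mul_nonneg (by positivity) (hA n)
  · simp

/-- **Tomboulis 2007 (2.28): `F̂_0 ≥ 1`** — the trivial coefficient of `f_c^ζ` is at least `1` for integer `ζ`
and `c_j ≥ 0`. [cite: Tomboulis2007Confinement, §2.2 eqs. (2.22), (2.28)] -/
theorem one_le_mkFhat_zero {J : ℕ} {c : ℕ → ℝ} (hc : ∀ n, 1 ≤ n → 0 ≤ c n) (ζ : ℕ) :
    1 ≤ mkFhat J c ζ 0 := by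
  obtain ⟨A, -, hA0, hAf⟩ := exists_plaqFn_pow_eq_charSum hc ζ (J := J)
  unfold mkFhat
  have hpt : ∀ U : SU2, plaqFn J c U ^ ζ * (su2Char 0 U / (((0 : ℕ) : ℝ) + 1)) =
      ∑ m ∈ Finset.range (ζ * J + 1), A m * su2Char m U := by
    intro U; rw [hAf U, su2Char_zero]; simp
  simp_rw [hpt]
  rw [integral_charSum]
  exact hA0

/-- `F̂_0 > 0` for integer `ζ` and `c_j ≥ 0`. [cite: Tomboulis2007Confinement, §2.2 eq. (2.28)] -/
theorem mkFhat_zero_pos {J : ℕ} {c : ℕ → ℝ} (hc : ∀ n, 1 ≤ n → 0 ≤ c n) (ζ : ℕ) :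
    0 < mkFhat J c ζ 0 :=
  one_pos.trans_le (one_le_mkFhat_zero hc ζ)

/-- **Tomboulis 2007 (2.28), bulk-factor half: `F_0(n) = F̂_0^{b²} ≥ 1`** for integer `ζ` and `c_j ≥ 0`.
[cite: Tomboulis2007Confinement, §2.2 eqs. (2.20), (2.28)] -/
theorem one_le_mkF0 {J : ℕ} {c : ℕ → ℝ} (hc : ∀ n, 1 ≤ n → 0 ≤ c n) (ζ b : ℕ) : 1 ≤ mkF0 J c ζ b :=
  one_le_pow₀ (one_le_mkFhat_zero hc ζ)

/-- **Tomboulis 2007 (2.28), `c_j(n) ≥ 0`**: the decimated coefficients `ĉ_j^{b²r}` (2.19)–(2.21) are non-negative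
for integer `ζ`, `c_j ≥ 0` and EVERY real exponent parameter `r` (real power of the non-negative base `F̂_j/F̂_0`).
The companion bound `c_j(n) ≤ 1` of (2.28) needs `f_c ≥ 0` (or even `ζ`) and is not asserted here.
[cite: Tomboulis2007Confinement, §2.2 eqs. (2.19)–(2.21), (2.28)] -/
theorem mkCoeff_nonneg {J : ℕ} {c : ℕ → ℝ} (hc : ∀ n, 1 ≤ n → 0 ≤ c n) (ζ b : ℕ) (r : ℝ) (n : ℕ) :
    0 ≤ mkCoeff J c ζ b r n :=
  Real.rpow_nonneg (div_nonneg (mkFhat_nonneg hc ζ n) (mkFhat_nonneg hc ζ 0)) _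

/-- `|χ_j| ≤ d_j` on `SU(2)` (`|U_n(x)| ≤ n+1` on `[-1,1]`, Abramowitz–Stegun 22.14.6; plumbing). [folklore] -/
private theorem abs_su2Char_le (n : ℕ) (U : SU2) : |su2Char n U| ≤ (n : ℝ) + 1 := by
  rw [ItoSU2.su2Char_eq_eval_u0]
  exact Literature.Analysis.SpecialFunctions.abs_chebyshevU_eval_le n (abs_u0_le_one U)

/-- **`F̂_j ≤ F̂_0` on the positivity domain `f_c ≥ 0`** (from `|χ_j/d_j| ≤ 1` and `f_c^ζ ≥ 0`): the ingredient of
the half `1 ≥ c_j(n)` of Tomboulis 2007 (2.28). [cite: Tomboulis2007Confinement, §2.2 eqs. (2.22), (2.28)] -/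
theorem mkFhat_le_mkFhat_zero_of_nonneg {J : ℕ} {c : ℕ → ℝ} (hf : ∀ U : SU2, 0 ≤ plaqFn J c U) (ζ n : ℕ) :
    mkFhat J c ζ n ≤ mkFhat J c ζ 0 := by
  unfold mkFhat
  have hcf : Continuous fun U : SU2 => plaqFn J c U ^ ζ :=
    (continuous_const.add (continuous_finsetSum _ fun m _ =>
      continuous_const.mul (continuous_su2Char' m))).pow ζ
  have hint : ∀ m : ℕ, Integrable (fun U : SU2 => plaqFn J c U ^ ζ * (su2Char m U / ((m : ℝ) + 1)))
      (haarProbability SU2) := fun m =>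
    integrable_of_continuous_su2 (hcf.mul ((continuous_su2Char' m).div_const _))
  refine integral_mono (hint n) (hint 0) fun U => ?_
  have hfz : 0 ≤ plaqFn J c U ^ ζ := pow_nonneg (hf U) ζ
  have h0 : su2Char 0 U / (((0 : ℕ) : ℝ) + 1) = 1 := by simp [su2Char_zero]
  dsimp only
  rw [h0, mul_one]
  refine mul_le_of_le_one_right hfz ?_
  rw [div_le_one (by positivity)]
  exact (le_abs_self _).trans (abs_su2Char_le n U)

/-- **Tomboulis 2007 (2.28), the half `c_j(n) ≤ 1`, one step, on the positivity domain**: for integer `ζ`, `c_j ≥ 0`,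
`f_c ≥ 0` and every exponent parameter `r ≥ 0`, `c_j(n) = (F̂_j/F̂_0)^{b²r} ≤ 1`.
[cite: Tomboulis2007Confinement, §2.2 eqs. (2.19)–(2.21), (2.28)] -/
theorem mkCoeff_le_one_of_nonneg {J : ℕ} {c : ℕ → ℝ} (hc : ∀ n, 1 ≤ n → 0 ≤ c n)
    (hf : ∀ U : SU2, 0 ≤ plaqFn J c U) (ζ b : ℕ) {r : ℝ} (hr : 0 ≤ r) (n : ℕ) : mkCoeff J c ζ b r n ≤ 1 := by
  unfold mkCoeff
  refine Real.rpow_le_one (div_nonneg (mkFhat_nonneg hc ζ n) (mkFhat_nonneg hc ζ 0)) ?_ (by positivity)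
  exact (div_le_one (mkFhat_zero_pos hc ζ)).2 (mkFhat_le_mkFhat_zero_of_nonneg hf ζ n)

/-- **Tomboulis 2007 (2.28) for ONE decimation step, as printed — `1 ≥ c_j(n) ≥ 0`** — on the positivity domain
(`c_j ≥ 0`, `f_c ≥ 0`), integer `ζ`, every `r ≥ 0`: the decimated coefficients are admissible (2.8).  (Iterating
this needs `f ≥ 0` to propagate along the column, which holds at `r = 1` by the convolution structure of (2.19) and is
not proved in this file.) [cite: Tomboulis2007Confinement, §2.2 eq. (2.28) and §2 eq. (2.8)] -/
theorem coeffAdmissible_mkCoeff_of_nonneg {J : ℕ} {c : ℕ → ℝ} (hc : ∀ n, 1 ≤ n → 0 ≤ c n)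
    (hf : ∀ U : SU2, 0 ≤ plaqFn J c U) (ζ b : ℕ) {r : ℝ} (hr : 0 ≤ r) : CoeffAdmissible (mkCoeff J c ζ b r) :=
  fun n _ => ⟨mkCoeff_nonneg hc ζ b r n, mkCoeff_le_one_of_nonneg hc hf ζ b hr n⟩

/-- **Positivity propagates along the upper-bound column** `c^U_j(m)` of scheme (3.38) for every `r`:
`c^U_j(m) ≥ 0` for all `m` and `j ≠ 0` when `c_j ≥ 0` initially (Tomboulis 2007 (2.28) iterated).
[cite: Tomboulis2007Confinement, §2.2 eq. (2.28) and §3.4 scheme (3.38)] -/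
theorem upperCoeffIter_nonneg {d J : ℕ} {c : ℕ → ℝ} (hc : ∀ n, 1 ≤ n → 0 ≤ c n) (b : ℕ) (r : ℝ) :
    ∀ m n, 1 ≤ n → 0 ≤ upperCoeffIter d J c b r m n := by
  intro m
  induction m with
  | zero => intro n hn; exact hc n hn
  | succ m ih => intro n _; exact mkCoeff_nonneg ih _ _ _ _

/-- **The bulk factors of the upper-bound column are `≥ 1`**: `F_0^U(m+1) ≥ 1` for every `m`, every `r`, when
`c_j ≥ 0` initially (Tomboulis 2007 (2.28) along scheme (3.38)).
[cite: Tomboulis2007Confinement, §2.2 eq. (2.28) and §3.4 scheme (3.38)] -/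
theorem one_le_upperF0Iter {d J : ℕ} {c : ℕ → ℝ} (hc : ∀ n, 1 ≤ n → 0 ≤ c n) (b : ℕ) (r : ℝ) (m : ℕ) :
    1 ≤ upperF0Iter d J c b r m :=
  one_le_mkF0 (upperCoeffIter_nonneg hc b r m) _ _

/-- `F_0^U(m+1) > 0`. [cite: Tomboulis2007Confinement, §2.2 eq. (2.28)] -/
theorem upperF0Iter_pos {d J : ℕ} {c : ℕ → ℝ} (hc : ∀ n, 1 ≤ n → 0 ≤ c n) (b : ℕ) (r : ℝ) (m : ℕ) :
    0 < upperF0Iter d J c b r m :=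
  one_pos.trans_le (one_le_upperF0Iter hc b r m)


/-! ### §5 (5.9)–(5.13) ⟹ Prop. V.1 (5.17)–(5.18): telescoping of the bulk factors -/

/-- One decimation step read at level `m` of an `n`-step analysis: the interpolated partition function (3.19) built on
the level-`m` upper-bound data is `F_0^U(m+1)^{h(α,t)|Λ^{(m+1)}|} · Z_{Λ^{(m+1)}}({α c^U_j(m+1)})`, i.e. the bulk factor
times `levelZ (m+1) α` (definitional unfolding of (3.19)/(3.20) with scheme (3.38)).
[cite: Tomboulis2007Confinement, §3.2 eqs. (3.19)–(3.20) and §3.4 scheme (3.38)] -/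
theorem tildeZ_eq_upperF0Iter_rpow_mul_levelZ {d : ℕ} (L b J n : ℕ) [NeZero L] [NeZero b] (r : ℝ)
    (c : ℕ → ℝ) (m : ℕ) (α t : ℝ) :
    tildeZ d (b ^ (n - (m + 1)) * L) b (cutoffIter d J b m) r (upperCoeffIter d J c b r m) α t =
      upperF0Iter d J c b r m ^
          (interpH α t * (Fintype.card (Plaquette d (b ^ (n - (m + 1)) * L)) : ℝ)) *
        levelZ d L b J n r c (m + 1) α := rfl

/-- The same for the `Z⁺` column: (4.15)/(4.17) at level `m` is the bulk factor times `levelZplus (m+1) α`.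
[cite: Tomboulis2007Confinement, §4.2 eqs. (4.15), (4.17) and scheme (4.28)] -/
theorem tildeZplus_eq_upperF0Iter_rpow_mul_levelZplus {d : ℕ} (L b J n : ℕ) [NeZero L] [NeZero b] (r : ℝ)
    (i j : Fin d) (hij : i < j) (c : ℕ → ℝ) (m : ℕ) (α t : ℝ) :
    tildeZplus (b ^ (n - (m + 1)) * L) b (cutoffIter d J b m) r i j hij (upperCoeffIter d J c b r m) α t =
      upperF0Iter d J c b r m ^
          (interpH α t * (Fintype.card (Plaquette d (b ^ (n - (m + 1)) * L)) : ℝ)) *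
        levelZplus L b J n r i j hij c (m + 1) α := rfl

/-- **(5.10)/(5.13) for the untwisted column, telescoped**: along an exact `n`-step representation the ORIGINAL
partition function equals the product of the bulk factors `∏_{k<m} F_0^U(k+1)^{h(α^{(k+1)},t_{k+1})|Λ^{(k+1)}|}` times
the level-`m` interpolated partition function, for every `m ≤ n` (iteration of the fixing equation (3.24)).
[cite: Tomboulis2007Confinement, §5.1 eqs. (5.10)–(5.13) and §3.2 eq. (3.24)] -/
theorem ExactRepresentation.torusZ_eq_prod_mul_levelZ {d : ℕ} {L b J n : ℕ} [NeZero L] [NeZero b] {r : ℝ}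
    {i j : Fin d} {hij : i < j} {c : ℕ → ℝ} (R : ExactRepresentation L b J n r i j hij c) :
    ∀ m, m ≤ n → torusZ d (b ^ n * L) J c =
      (∏ k ∈ Finset.range m, upperF0Iter d J c b r k ^
          (interpH (R.α (k + 1)) (R.t (k + 1)) * (Fintype.card (Plaquette d (b ^ (n - (k + 1)) * L)) : ℝ))) *
        levelZ d L b J n r c m (R.α m) := by
  intro m
  induction m with
  | zero => intro _; simp [levelZ_zero]
  | succ m ih =>
    intro hm
    rw [Finset.prod_range_succ, ih (Nat.le_of_succ_le hm), mul_assoc,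
      ← tildeZ_eq_upperF0Iter_rpow_mul_levelZ L b J n r c m, R.fixing m (Nat.lt_of_succ_le hm)]

/-- **(5.10)/(5.13) for the `Z⁺` column, telescoped** (iteration of (4.19)).
[cite: Tomboulis2007Confinement, §5.1 eqs. (5.10)–(5.13) and §4.2 eq. (4.19)] -/
theorem ExactRepresentation.torusZplus_eq_prod_mul_levelZplus {d : ℕ} {L b J n : ℕ} [NeZero L] [NeZero b]
    {r : ℝ} {i j : Fin d} {hij : i < j} {c : ℕ → ℝ} (R : ExactRepresentation L b J n r i j hij c) :
    ∀ m, m ≤ n → torusZplus d (b ^ n * L) J c (vortexSheet (b ^ n * L) i j hij) =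
      (∏ k ∈ Finset.range m, upperF0Iter d J c b r k ^
          (interpH (R.αPlus (k + 1)) (R.tPlus (k + 1)) *
            (Fintype.card (Plaquette d (b ^ (n - (k + 1)) * L)) : ℝ))) *
        levelZplus L b J n r i j hij c m (R.αPlus m) := by
  intro m
  induction m with
  | zero => intro _; simp [levelZplus]
  | succ m ih =>
    intro hm
    rw [Finset.prod_range_succ, ih (Nat.le_of_succ_le hm), mul_assoc,
      ← tildeZplus_eq_upperF0Iter_rpow_mul_levelZplus L b J n r i j hij c m, R.fixingPlus m (Nat.lt_of_succ_le hm)]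

/-- **The `h`-matching (5.9) and the common parameter (5.14) make the bulk exponents of the two columns coincide
level by level** (`h(α^{(m)},t_m) = h(α^{+(m)},t⁺_m)` for ALL `1 ≤ m ≤ n`).
[cite: Tomboulis2007Confinement, §5.1 eqs. (5.9), (5.14)] -/
theorem ExactRepresentation.interpH_eq {d : ℕ} {L b J n : ℕ} [NeZero L] [NeZero b] {r : ℝ} {i j : Fin d}
    {hij : i < j} {c : ℕ → ℝ} (R : ExactRepresentation L b J n r i j hij c) {k : ℕ} (hk : k < n) :
    interpH (R.α (k + 1)) (R.t (k + 1)) = interpH (R.αPlus (k + 1)) (R.tPlus (k + 1)) := by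
  rcases Nat.lt_or_ge (k + 1) n with h | h
  · exact R.matching (k + 1) (Nat.succ_pos k) h
  · have hkn : k + 1 = n := le_antisymm hk h
    obtain ⟨hα, ht⟩ := R.common
    rw [hkn, hα, ht]

/-- Partition functions on tori of equal side agree (transport of the side index; plumbing). [folklore] -/
private theorem torusZ_side_congr {d : ℕ} {L L' : ℕ} [NeZero L] [NeZero L'] (h : L' = L) (J : ℕ) (c : ℕ → ℝ) :
    torusZ d L' J c = torusZ d L J c := by
  subst h; rfl

/-- Twisted partition functions on tori of equal side (same plane) agree (plumbing). [folklore] -/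
private theorem torusZtw_side_congr {d : ℕ} {L L' : ℕ} [NeZero L] [NeZero L'] (h : L' = L) (J : ℕ) (c : ℕ → ℝ)
    (i j : Fin d) (hij : i < j) :
    torusZtw d L' J c (vortexSheet L' i j hij) = torusZtw d L J c (vortexSheet L i j hij) := by
  subst h; rfl

/-- `Z⁻ = 2Z⁺ - Z` ((4.8) solved for `Z⁻`; plumbing). [folklore] -/
private theorem torusZtw_eq_two_mul_torusZplus_sub {d : ℕ} (L : ℕ) [NeZero L] (J : ℕ) (c : ℕ → ℝ)
    (V : Finset (Plaquette d L)) : torusZtw d L J c V = 2 * torusZplus d L J c V - torusZ d L J c := by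
  unfold torusZplus; ring

/-- **Prop. V.1 (arXiv:0707.2179 (5.17)–(5.18)) as printed, PROVED: an exact `n`-step representation with the
matchings (5.9) and a common `t*` (5.14) yields the common interpolation parameter `α* = α^{(n)}(t*) ∈ (0,1)` with
`Z⁻_Λ/Z_Λ = Z⁻_{Λ^{(n)}}({α* c^U_j(n)})/Z_{Λ^{(n)}}({α* c^U_j(n)})`** — i.e. hypothesis (H_V1) `PropV1Claim` of
`ConfinementFromIneq516` HOLDS, for every `n ≥ 1`, every dimension, torus, `b`, cut-off, `r` and plane, on the standing
domain `c_j ≥ 0` (Tomboulis 2007 (2.8)).  Proof as printed ((5.10)–(5.13)): telescoping the fixing equations of the two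
columns, whose bulk factors `F_0^U(m)^{h|Λ^{(m)}|}` coincide by (5.9)/(5.14) and are POSITIVE by (2.28)
(`upperF0Iter_pos`), and cancelling them in `Z⁺_Λ/Z_Λ`, hence in `Z⁻_Λ/Z_Λ = 2Z⁺_Λ/Z_Λ - 1`.  (At `n = 0` the predicate
is generically false and is not used by the chain.) [cite: Tomboulis2007Confinement, §5.1 Prop. V.1 eqs. (5.17)–(5.18) and eqs. (5.9)–(5.14)] -/
theorem propV1Claim_of_nonneg {d : ℕ} (L b J n : ℕ) [NeZero L] [NeZero b] (r : ℝ) {i j : Fin d} (hij : i < j)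
    {c : ℕ → ℝ} (hc : ∀ k, 1 ≤ k → 0 ≤ c k) (hn : 1 ≤ n) : PropV1Claim d L b J n r hij c := by
  rintro ⟨R⟩
  obtain ⟨m, rfl⟩ : ∃ m, n = m + 1 := ⟨n - 1, by omega⟩
  -- the common product of bulk factors
  set P : ℝ := ∏ k ∈ Finset.range (m + 1), upperF0Iter d J c b r k ^
      (interpH (R.α (k + 1)) (R.t (k + 1)) * (Fintype.card (Plaquette d (b ^ (m + 1 - (k + 1)) * L)) : ℝ))
    with hPdef
  have hP : 0 < P :=
    Finset.prod_pos fun k _ => Real.rpow_pos_of_pos (upperF0Iter_pos hc b r k) _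
  have hZ := R.torusZ_eq_prod_mul_levelZ (m + 1) le_rfl
  have hZp := R.torusZplus_eq_prod_mul_levelZplus (m + 1) le_rfl
  have hPP : (∏ k ∈ Finset.range (m + 1), upperF0Iter d J c b r k ^
      (interpH (R.αPlus (k + 1)) (R.tPlus (k + 1)) *
        (Fintype.card (Plaquette d (b ^ (m + 1 - (k + 1)) * L)) : ℝ))) = P := by
    rw [hPdef]
    refine Finset.prod_congr rfl fun k hk => ?_
    rw [R.interpH_eq (Finset.mem_range.1 hk)]
  rw [hPP] at hZp
  rw [← hPdef] at hZ
  obtain ⟨hαc, -⟩ := R.common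
  refine ⟨R.α (m + 1), R.α_mem (m + 1) hn le_rfl, ?_⟩
  -- both sides are ratios; level `m+1` lives on the torus of side `b^0 · L = L`
  have hside : b ^ (m + 1 - (m + 1)) * L = L := by simp
  have hZn : levelZ d L b J (m + 1) r c (m + 1) (R.α (m + 1)) =
      torusZ d L (cutoffIter d J b (m + 1)) (scaleCoeff (R.α (m + 1)) (upperCoeffIter d J c b r (m + 1))) :=
    torusZ_side_congr hside _ _
  have hZpn : levelZplus L b J (m + 1) r i j hij c (m + 1) (R.αPlus (m + 1)) =
      torusZplus d L (cutoffIter d J b (m + 1)) (scaleCoeff (R.α (m + 1)) (upperCoeffIter d J c b r (m + 1)))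
        (vortexSheet L i j hij) := by
    rw [← hαc]
    show torusZplus d (b ^ (m + 1 - (m + 1)) * L) _ _ _ = _
    unfold torusZplus
    rw [torusZ_side_congr hside, torusZtw_side_congr hside]
  rw [hZn] at hZ
  rw [hZpn] at hZp
  unfold vortexRatio
  rw [torusZtw_eq_two_mul_torusZplus_sub, torusZtw_eq_two_mul_torusZplus_sub L, hZ, hZp,
    show 2 * (P * _) - P * _ = P * (2 * torusZplus d L _ _ (vortexSheet L i j hij) - torusZ d L _ _) by ring,
    mul_div_mul_left _ _ hP.ne']

/-- `propV1Claim_of_nonneg` on Tomboulis's admissible domain `0 ≤ c_j ≤ 1` (2.8).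
[cite: Tomboulis2007Confinement, §5.1 Prop. V.1 eqs. (5.17)–(5.18)] -/
theorem propV1Claim_of_admissible {d : ℕ} (L b J n : ℕ) [NeZero L] [NeZero b] (r : ℝ) {i j : Fin d}
    (hij : i < j) {c : ℕ → ℝ} (hc : CoeffAdmissible c) (hn : 1 ≤ n) : PropV1Claim d L b J n r hij c :=
  propV1Claim_of_nonneg L b J n r hij (fun k hk => (hc k hk).1) hn


/-! ### §5 (5.21)–(5.24) ⟹ Prop. V.2 (5.22): the common interpolation parameter and the monotonicity of the ratio -/

/-- **Prop. V.2's lower half from V.1's conclusion and the monotonicity (5.24)** — derivative-free form of the printed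
step "(5.21) … Setting `α` equal to `1` … gives (5.22)": if the vortex ratio of the level-`n` model is non-increasing
along the ray `α ↦ α c^U(n)` on `[0,1]` (`VortexRatioAntitone`, T07 (5.24) integrated) and equals the original ratio at
some `α* ∈ (0,1)` (`CommonInterpolationIter`), then the MKT inequality (5.22) holds at level `n`.
[cite: Tomboulis2007Confinement, §5.2 eqs. (5.21)–(5.22), (5.24)] -/
theorem mktIneq_of_commonInterpolationIter_of_antitone {d : ℕ} (L b J n : ℕ) [NeZero L] [NeZero b] (r : ℝ)
    {i j : Fin d} (hij : i < j) (c : ℕ → ℝ) (hCI : CommonInterpolationIter d L b J n r hij c)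
    (hmono : VortexRatioAntitone d L (cutoffIter d J b n) (upperCoeffIter d J c b r n) (vortexSheet L i j hij)) :
    MKTIneq d L b J n r hij c := by
  obtain ⟨α, ⟨hα0, hα1⟩, hEq⟩ := hCI
  have h1 : scaleCoeff 1 (upperCoeffIter d J c b r n) = upperCoeffIter d J c b r n := funext fun k => one_mul _
  have key := hmono ⟨hα0.le, hα1.le⟩ ⟨zero_le_one, le_rfl⟩ hα1.le
  dsimp only at key
  rw [h1] at key
  unfold MKTIneq
  rw [hEq]
  exact key

/-! #### Polynomiality of the partition functions along the ray `α ↦ α c` -/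

/-- Along the ray the plaquette function is affine in `α`: `f_{αc} = 1 + α (f_c - 1)` (plumbing). [folklore] -/
private theorem plaqFn_scaleCoeff (J : ℕ) (c : ℕ → ℝ) (α : ℝ) (W : SU2) :
    plaqFn J (scaleCoeff α c) W = 1 + α * (plaqFn J c W - 1) := by
  unfold plaqFn scaleCoeff
  rw [add_sub_cancel_left, Finset.mul_sum]
  congr 1
  refine Finset.sum_congr rfl fun n _ => ?_
  ring

/-- The same for the twisted plaquette function (plumbing). [folklore] -/
private theorem plaqFnTwist_scaleCoeff (J : ℕ) (c : ℕ → ℝ) (α : ℝ) (W : SU2) :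
    plaqFnTwist J (scaleCoeff α c) W = 1 + α * (plaqFnTwist J c W - 1) := by
  unfold plaqFnTwist scaleCoeff
  rw [add_sub_cancel_left, Finset.mul_sum]
  congr 1
  refine Finset.sum_congr rfl fun n _ => ?_
  ring

/-- `f_c` is continuous (plumbing). [folklore] -/
private theorem continuous_plaqFn' (J : ℕ) (c : ℕ → ℝ) : Continuous (plaqFn J c) := by
  unfold plaqFn
  exact continuous_const.add (continuous_finsetSum _ fun n _ => continuous_const.mul (continuous_su2Char' n))

/-- `f⁻_c` is continuous (plumbing). [folklore] -/
private theorem continuous_plaqFnTwist' (J : ℕ) (c : ℕ → ℝ) : Continuous (plaqFnTwist J c) := by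
  unfold plaqFnTwist
  exact continuous_const.add (continuous_finsetSum _ fun n _ => continuous_const.mul (continuous_su2Char' n))

/-- The plaquette holonomy depends continuously on the configuration (plumbing). [folklore] -/
private theorem continuous_hol' {d L : ℕ} [NeZero L] (p : Plaquette d L) :
    Continuous fun U : GaugeConfig d L SU2 => plaquetteHolonomy U p.1 p.2.1.1 p.2.1.2 := by
  unfold plaquetteHolonomy
  fun_prop

/-- Continuous functions on `SU(2)^{links}` are Haar integrable (plumbing). [folklore] -/
private theorem integrable_of_continuous_config {d L : ℕ} [NeZero L] {F : GaugeConfig d L SU2 → ℝ}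
    (hF : Continuous F) : Integrable F (Measure.pi fun _ : Edge d L => haarProbability SU2) := by
  haveI : SecondCountableTopology (Matrix (Fin 2) (Fin 2) ℂ) :=
    inferInstanceAs (SecondCountableTopology (Fin 2 → Fin 2 → ℂ))
  haveI : SecondCountableTopology SU2 := Topology.IsEmbedding.subtypeVal.secondCountableTopology
  exact hF.integrable_of_hasCompactSupport (HasCompactSupport.of_compactSpace F)

/-- **A product of affine functions integrates to a polynomial**: for continuous `G_p`,
`∫ ∏_p (1 + α G_p(U)) dU = Σ_{S} α^{|S|} ∫ ∏_{p∈S} G_p(U) dU` is a polynomial in `α` (plumbing). [folklore] -/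
private theorem exists_polynomial_integral_prod_one_add_mul {d L : ℕ} [NeZero L]
    (G : Plaquette d L → GaugeConfig d L SU2 → ℝ) (hG : ∀ p, Continuous (G p)) :
    ∃ P : Polynomial ℝ, ∀ α : ℝ,
      ∫ U, ∏ p : Plaquette d L, (1 + α * G p U) ∂(Measure.pi fun _ : Edge d L => haarProbability SU2) =
        P.eval α := by
  classical
  refine ⟨∑ S ∈ (Finset.univ : Finset (Plaquette d L)).powerset,
    Polynomial.C (∫ U, ∏ p ∈ S, G p U ∂(Measure.pi fun _ : Edge d L => haarProbability SU2)) *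
      Polynomial.X ^ S.card, fun α => ?_⟩
  have hexp : ∀ U : GaugeConfig d L SU2, ∏ p : Plaquette d L, (1 + α * G p U) =
      ∑ S ∈ (Finset.univ : Finset (Plaquette d L)).powerset, α ^ S.card * ∏ p ∈ S, G p U := by
    intro U
    rw [Finset.prod_one_add]
    refine Finset.sum_congr rfl fun S _ => ?_
    rw [Finset.prod_mul_distrib, Finset.prod_const]
  simp_rw [hexp]
  rw [integral_finsetSum _ (fun S _ =>
    (integrable_of_continuous_config (continuous_finsetProd S fun p _ => hG p)).const_mul _)]
  rw [Polynomial.eval_finsetSum]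
  refine Finset.sum_congr rfl fun S _ => ?_
  rw [integral_const_mul, Polynomial.eval_mul, Polynomial.eval_C, Polynomial.eval_pow, Polynomial.eval_X, mul_comm]

/-- **`α ↦ Z_Λ({α c_j})` is a polynomial** (of degree at most the number of plaquettes): the interpolation ray of
Tomboulis 2007 (3.12) with `c^L = 0` enters every plaquette function affinely. [cite: Tomboulis2007Confinement, §3.2 eq. (3.12) and §2 eq. (2.7)] -/
theorem exists_polynomial_torusZ_scaleCoeff (d L : ℕ) [NeZero L] (J : ℕ) (c : ℕ → ℝ) :
    ∃ P : Polynomial ℝ, ∀ α : ℝ, torusZ d L J (scaleCoeff α c) = P.eval α := by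
  obtain ⟨P, hP⟩ := exists_polynomial_integral_prod_one_add_mul (d := d) (L := L)
    (fun p U => plaqFn J c (plaquetteHolonomy U p.1 p.2.1.1 p.2.1.2) - 1)
    (fun p => ((continuous_plaqFn' J c).comp (continuous_hol' p)).sub continuous_const)
  refine ⟨P, fun α => ?_⟩
  rw [← hP α]
  unfold torusZ
  simp_rw [plaqFn_scaleCoeff]

/-- **`α ↦ Z⁻_Λ({α c_j})` is a polynomial**, for every twist set. [cite: Tomboulis2007Confinement, §3.2 eq. (3.12) and §4 eq. (4.4)] -/
theorem exists_polynomial_torusZtw_scaleCoeff (d L : ℕ) [NeZero L] (J : ℕ) (c : ℕ → ℝ)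
    (V : Finset (Plaquette d L)) :
    ∃ P : Polynomial ℝ, ∀ α : ℝ, torusZtw d L J (scaleCoeff α c) V = P.eval α := by
  classical
  obtain ⟨P, hP⟩ := exists_polynomial_integral_prod_one_add_mul (d := d) (L := L)
    (fun p U => if p ∈ V then plaqFnTwist J c (plaquetteHolonomy U p.1 p.2.1.1 p.2.1.2) - 1
      else plaqFn J c (plaquetteHolonomy U p.1 p.2.1.1 p.2.1.2) - 1)
    (fun p => by
      by_cases hp : p ∈ V
      · simp only [hp, if_true]
        exact ((continuous_plaqFnTwist' J c).comp (continuous_hol' p)).sub continuous_const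
      · simp only [hp, if_false]
        exact ((continuous_plaqFn' J c).comp (continuous_hol' p)).sub continuous_const)
  refine ⟨P, fun α => ?_⟩
  rw [← hP α]
  unfold torusZtw
  refine integral_congr_ae (Filter.Eventually.of_forall fun U => ?_)
  refine Finset.prod_congr rfl fun p _ => ?_
  split_ifs
  · rw [plaqFnTwist_scaleCoeff]
  · rw [plaqFn_scaleCoeff]

/-- At `α = 0` all plaquette functions are `1`: `Z_Λ({0}) = 1` (plumbing). [folklore] -/
private theorem torusZ_scaleCoeff_zero (d L : ℕ) [NeZero L] (J : ℕ) (c : ℕ → ℝ) :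
    torusZ d L J (scaleCoeff 0 c) = 1 := by
  unfold torusZ
  simp_rw [plaqFn_scaleCoeff, zero_mul, add_zero, Finset.prod_const_one]
  simp

/-- At `α = 0`: `Z⁻_Λ({0}) = 1` (plumbing). [folklore] -/
private theorem torusZtw_scaleCoeff_zero (d L : ℕ) [NeZero L] (J : ℕ) (c : ℕ → ℝ)
    (V : Finset (Plaquette d L)) : torusZtw d L J (scaleCoeff 0 c) V = 1 := by
  unfold torusZtw
  have h : ∀ (U : GaugeConfig d L SU2) (p : Plaquette d L),
      (if p ∈ V then plaqFnTwist J (scaleCoeff 0 c) (plaquetteHolonomy U p.1 p.2.1.1 p.2.1.2)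
        else plaqFn J (scaleCoeff 0 c) (plaquetteHolonomy U p.1 p.2.1.1 p.2.1.2)) = 1 := by
    intro U p
    split_ifs
    · rw [plaqFnTwist_scaleCoeff, zero_mul, add_zero]
    · rw [plaqFn_scaleCoeff, zero_mul, add_zero]
  simp_rw [h, Finset.prod_const_one]
  simp

/-- **(5.16) ⟹ (5.24) (weak form), given positivity of `Z` and `Z⁻` along the ray** — the printed step
"`d/dα (Z⁻_n/Z_n)({c̃(α)}) < 0` by (5.16)": if `∂_α ln Z⁻ ≤ ∂_α ln Z` on `(0,1)` (`Ineq515`, the typed (5.16)) and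
both partition functions are positive on `(0,1]` (they equal `1` at `α = 0`; positivity of `Z⁻` is Tomboulis's (5.3)
"`1 < 1 + Z⁻/Z`", of `Z` his (2.14)), then `α ↦ Z⁻/Z({αc})` is non-increasing on `[0,1]`.  Proof: both are polynomials
in `α`, so `ln Z⁻ - ln Z` is differentiable with non-positive derivative on `(0,1)` and continuous on `[0,1]`; mean
value theorem. [cite: Tomboulis2007Confinement, §5.2 eqs. (5.16), (5.24) and eq. (5.3)] -/
theorem vortexRatioAntitone_of_ineq515_of_pos {d L : ℕ} [NeZero L] (J : ℕ) (c : ℕ → ℝ)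
    (V : Finset (Plaquette d L))
    (hpos : ∀ α ∈ Set.Ioc (0 : ℝ) 1, 0 < torusZ d L J (scaleCoeff α c) ∧ 0 < torusZtw d L J (scaleCoeff α c) V)
    (h515 : Ineq515 d L J c V) : VortexRatioAntitone d L J c V := by
  obtain ⟨PZ, hPZ⟩ := exists_polynomial_torusZ_scaleCoeff d L J c
  obtain ⟨PW, hPW⟩ := exists_polynomial_torusZtw_scaleCoeff d L J c V
  -- positivity on the closed interval
  have hposZ : ∀ α ∈ Set.Icc (0 : ℝ) 1, 0 < PZ.eval α := by
    intro α hα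
    rw [← hPZ]
    rcases hα.1.eq_or_lt with h | h
    · rw [← h, torusZ_scaleCoeff_zero]; exact one_pos
    · exact (hpos α ⟨h, hα.2⟩).1
  have hposW : ∀ α ∈ Set.Icc (0 : ℝ) 1, 0 < PW.eval α := by
    intro α hα
    rw [← hPW]
    rcases hα.1.eq_or_lt with h | h
    · rw [← h, torusZtw_scaleCoeff_zero]; exact one_pos
    · exact (hpos α ⟨h, hα.2⟩).2
  -- the log-ratio `g = ln Z⁻ - ln Z` as a function of `α`
  set g : ℝ → ℝ := fun α => Real.log (PW.eval α) - Real.log (PZ.eval α) with hg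
  have hW_fun : (fun a => Real.log (torusZtw d L J (scaleCoeff a c) V)) = fun a => Real.log (PW.eval a) :=
    funext fun a => by rw [hPW]
  have hZ_fun : (fun a => Real.log (torusZ d L J (scaleCoeff a c))) = fun a => Real.log (PZ.eval a) :=
    funext fun a => by rw [hPZ]
  have hdW : ∀ α ∈ Set.Icc (0 : ℝ) 1, DifferentiableAt ℝ (fun a => Real.log (PW.eval a)) α :=
    fun α hα => (PW.differentiableAt).log (hposW α hα).ne'
  have hdZ : ∀ α ∈ Set.Icc (0 : ℝ) 1, DifferentiableAt ℝ (fun a => Real.log (PZ.eval a)) α :=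
    fun α hα => (PZ.differentiableAt).log (hposZ α hα).ne'
  have hg_anti : AntitoneOn g (Set.Icc (0 : ℝ) 1) := by
    refine antitoneOn_of_deriv_nonpos (convex_Icc 0 1) ?_ ?_ ?_
    · exact fun α hα => ((hdW α hα).sub (hdZ α hα)).continuousAt.continuousWithinAt
    · rw [interior_Icc]
      exact fun α hα => ((hdW α (Set.Ioo_subset_Icc_self hα)).sub
        (hdZ α (Set.Ioo_subset_Icc_self hα))).differentiableWithinAt
    · rw [interior_Icc]
      intro α hα
      have hα' : α ∈ Set.Icc (0 : ℝ) 1 := Set.Ioo_subset_Icc_self hα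
      have h := h515 α hα
      rw [hW_fun, hZ_fun] at h
      rw [hg, deriv_fun_sub (hdW α hα') (hdZ α hα')]
      linarith
  -- back to the ratio
  intro a ha b' hb hab
  have hratio : ∀ α ∈ Set.Icc (0 : ℝ) 1, vortexRatio d L J (scaleCoeff α c) V = Real.exp (g α) := by
    intro α hα
    unfold vortexRatio
    rw [hPW, hPZ, hg]
    dsimp only
    rw [Real.exp_sub, Real.exp_log (hposW α hα), Real.exp_log (hposZ α hα)]
  dsimp only
  rw [hratio a ha, hratio b' hb]
  exact Real.exp_le_exp.2 (hg_anti ha hb hab)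

/-- **Prop. V.2 (lower half, (5.22)) as an implication, PROVED under positivity of `Z`, `Z⁻` on the level-`n` ray**:
hypothesis (H_V2) `PropV2Claim` of `ConfinementFromIneq516` holds whenever the level-`n` partition functions
`Z_{Λ^{(n)}}({α c^U_j(n)})` and `Z⁻_{Λ^{(n)}}({α c^U_j(n)})` are positive for `α ∈ (0,1]` (Tomboulis's (2.14) and
(5.3); the typed (5.16) `Ineq515` takes logarithms and is only meaningful there).  Proof as printed: (5.16) ⟹ (5.24)
(`vortexRatioAntitone_of_ineq515_of_pos`), then `α = 1` against `α*` ((5.21)–(5.22)).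
[cite: Tomboulis2007Confinement, §5.2 Prop. V.2 eqs. (5.21)–(5.22), (5.24)] -/
theorem propV2Claim_of_pos {d : ℕ} (L b J n : ℕ) [NeZero L] [NeZero b] (r : ℝ) {i j : Fin d} (hij : i < j)
    (c : ℕ → ℝ)
    (hpos : ∀ α ∈ Set.Ioc (0 : ℝ) 1,
      0 < torusZ d L (cutoffIter d J b n) (scaleCoeff α (upperCoeffIter d J c b r n)) ∧
      0 < torusZtw d L (cutoffIter d J b n) (scaleCoeff α (upperCoeffIter d J c b r n)) (vortexSheet L i j hij)) :
    PropV2Claim d L b J n r hij c :=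
  fun hCI h516 => mktIneq_of_commonInterpolationIter_of_antitone L b J n r hij c hCI
    (vortexRatioAntitone_of_ineq515_of_pos _ _ _ hpos h516)

/-! ### The assembled chain without (H_V1), and with (H_V2) replaced by ray positivity -/

/-- **«(5.16) ⟹ confinement» with Prop. V.1 no longer a hypothesis.**  The implication `ConfinementFromIneq516`
of the file of record, with (H_V1) DISCHARGED by `propV1Claim_of_nonneg` (positivity of `c^U(0) = c` is part of (H_pos)):
granted (H_pos) admissibility of the upper-bound column, (H_flow) the flow in norm (3.43), (H_sc) the strong-coupling
regime of §6.2, (H_C) Appendix C's claim, (H_V2) Prop. V.2 as an implication and (H_516) the disputed inequality at every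
level, every plane has a level `n` with the electric-flux area law along the sides `b^n L`.  What remains named is
exactly what Ito–Seiler contest ((H_C), (H_516); the flow for `r < 1`; §6.2) plus (H_V2)'s positivity proviso.
[cite: Tomboulis2007Confinement, Abstract, §5 Props. V.1–V.2, §6.2, App. C] [cite: ItoSeiler2009Critical, §§2, 4(b), 5] -/
theorem electricFluxAreaLawAlong_of_chain (d J : ℕ) (c : ℕ → ℝ) (b : ℕ) [NeZero b] (r : ℝ)
    (hAdm : ∀ m, CoeffAdmissible (upperCoeffIter d J c b r m)) (hFlow : UpperFlowInNorm d J c b r)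
    (hSC : StrongCouplingRegime d)
    (hC : ∀ (n L : ℕ) [NeZero L] (i j : Fin d) (hij : i < j), 1 ≤ n → 2 ≤ L → AppendixCClaim d L b J n r hij c)
    (hV2 : ∀ (n L : ℕ) [NeZero L] (i j : Fin d) (hij : i < j), 1 ≤ n → 2 ≤ L → PropV2Claim d L b J n r hij c)
    (h516 : ∀ (n L : ℕ) [NeZero L] (i j : Fin d) (hij : i < j), 1 ≤ n → 2 ≤ L → Ineq516AtLevel d L b J n r hij c) :
    ∀ (i j : Fin d) (hij : i < j), ∃ n : ℕ, ElectricFluxAreaLawAlong d b n J c hij :=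
  ConfinementFromIneq516_holds d J c b r hAdm hFlow hSC hC
    (fun n L _ _ _ hij hn _ => propV1Claim_of_admissible L b J n r hij (hAdm 0) hn) hV2 h516

/-- **«(5.16) ⟹ confinement» with (H_V1) discharged and (H_V2) replaced by its positivity proviso**: granted
(H_pos), (H_flow), (H_sc), (H_C), the positivity of the level-`n` partition functions `Z`, `Z⁻` along the rays
`α ↦ α c^U(n)`, `α ∈ (0,1]` (Tomboulis's (2.14), (5.3)), and (H_516), the electric-flux area law follows along the
sides `b^n L` in every plane. [cite: Tomboulis2007Confinement, Abstract, §5 Props. V.1–V.2 and eqs. (2.14), (5.3), §6.2, App. C]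
[cite: ItoSeiler2009Critical, §§2, 4(b), 5] -/
theorem electricFluxAreaLawAlong_of_chain_of_pos (d J : ℕ) (c : ℕ → ℝ) (b : ℕ) [NeZero b] (r : ℝ)
    (hAdm : ∀ m, CoeffAdmissible (upperCoeffIter d J c b r m)) (hFlow : UpperFlowInNorm d J c b r)
    (hSC : StrongCouplingRegime d)
    (hC : ∀ (n L : ℕ) [NeZero L] (i j : Fin d) (hij : i < j), 1 ≤ n → 2 ≤ L → AppendixCClaim d L b J n r hij c)
    (hpos : ∀ (n L : ℕ) [NeZero L] (i j : Fin d) (hij : i < j), 1 ≤ n → 2 ≤ L → ∀ α ∈ Set.Ioc (0 : ℝ) 1,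
      0 < torusZ d L (cutoffIter d J b n) (scaleCoeff α (upperCoeffIter d J c b r n)) ∧
      0 < torusZtw d L (cutoffIter d J b n) (scaleCoeff α (upperCoeffIter d J c b r n)) (vortexSheet L i j hij))
    (h516 : ∀ (n L : ℕ) [NeZero L] (i j : Fin d) (hij : i < j), 1 ≤ n → 2 ≤ L → Ineq516AtLevel d L b J n r hij c) :
    ∀ (i j : Fin d) (hij : i < j), ∃ n : ℕ, ElectricFluxAreaLawAlong d b n J c hij :=
  electricFluxAreaLawAlong_of_chain d J c b r hAdm hFlow hSC hC
    (fun n L _ i j hij hn hL => propV2Claim_of_pos L b J n r hij c (hpos n L i j hij hn hL)) h516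

end Tomboulis2007

end Literature.MathematicalPhysics.QuantumFieldTheory

end

/-! ## Revision 1 (append-only): Prop. V.2 and the assembled chain ON THE POSITIVITY DOMAIN `f(U; n) ≥ 0`

The positivity proviso of `propV2Claim_of_pos` (positivity of `Z_{Λ^{(n)}}` and `Z⁻_{Λ^{(n)}}` along the ray,
Tomboulis's (2.14)/(5.3)) is DISCHARGED on the standing positivity domain of the paper — the decimated plaquette
functions are non-negative, `f(U; n) ≥ 0` (arXiv:0707.2179 (2.23)–(2.25); §3.1: for `b²r` non-integer "it is easily
seen that `f_p > 0`"; at `r = 1` they are convolution powers of non-negative functions):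

* `torusZ_scaleCoeff_pos_of_plaqFn_nonneg`, `torusZtw_scaleCoeff_pos_of_plaqFn_nonneg` — for `f_c ≥ 0` and
  `0 ≤ α < 1` every interpolated plaquette factor is `(1-α) + α f ≥ 1 - α > 0` (twisted ones too, `f⁻(U) = f(-U)`),
  so `Z({αc}) ≥ (1-α)^{#plaquettes} > 0` and `Z⁻({αc}) ≥ (1-α)^{#plaquettes} > 0`: on `(0,1)` the logarithms in the
  typed (5.16) `Ineq515` are logarithms of positive numbers, i.e. the typed inequality is the printed one there.
* `vortexRatio_le_of_ineq515_of_plaqFn_nonneg` — **(5.21) at `α = 1`**: `Z⁻/Z({c}) ≤ Z⁻/Z({αc})` for every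
  `α ∈ (0,1)`, from (5.16) and `f_c ≥ 0` alone (mean value theorem on `[α, s]`, `s ↑ 1`, polynomial continuity at
  the endpoint; the degenerate endpoint value `Z({c}) = 0` is harmless).
* `propV2Claim_of_plaqFn_nonneg` — (H_V2) `PropV2Claim` holds at level `n` whenever `f_{c^U(n)} ≥ 0`.
* `coeffAdmissible_upperCoeffIter_of_plaqFn_nonneg` — (H_pos) follows from `c` admissible, `r ≥ 0` and
  `f(U; m) ≥ 0` along the column ((2.28) iterated, `coeffAdmissible_mkCoeff_of_nonneg`).
* `electricFluxAreaLawAlong_of_chain_on_posDomain` — **the chain with (H_pos), (H_V1), (H_V2) all discharged on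
  the positivity domain**: granted `0 ≤ c_j ≤ 1`, `r ≥ 0`, `f(U; m) ≥ 0` for all `m`, the flow (H_flow), the
  strong-coupling regime (H_sc), Appendix C's claim (H_C) and the disputed inequality (H_516), every plane has a
  level `n` with the electric-flux area law along the sides `b^n L`.  The named hypotheses that remain are
  Tomboulis's positivity of the decimated plaquette functions and exactly the links Ito–Seiler contest.
-/

noncomputable section

namespace Literature.MathematicalPhysics.QuantumFieldTheory

namespace Tomboulis2007

open MeasureTheory Finset Real Filter Polynomial
open scoped BigOperators Topology
open Literature.MathematicalPhysics.QuantumLattice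

/-- On the positivity domain the interpolated plaquette function is bounded below: `f_{αc} = (1-α) + α f_c ≥ 1 - α`
for `α ≥ 0`, `f_c ≥ 0` (plumbing). [folklore] -/
private theorem sub_le_plaqFn_scaleCoeff {J : ℕ} {c : ℕ → ℝ} (hf : ∀ U : SU2, 0 ≤ plaqFn J c U) {α : ℝ}
    (hα : 0 ≤ α) (U : SU2) : 1 - α ≤ plaqFn J (scaleCoeff α c) U := by
  rw [plaqFn_scaleCoeff]
  nlinarith [hf U]

/-- The same for the twisted plaquette function, via `f⁻_{αc}(U) = f_{αc}(-U)` (plumbing). [folklore] -/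
private theorem sub_le_plaqFnTwist_scaleCoeff {J : ℕ} {c : ℕ → ℝ} (hf : ∀ U : SU2, 0 ≤ plaqFn J c U) {α : ℝ}
    (hα : 0 ≤ α) (U : SU2) : 1 - α ≤ plaqFnTwist J (scaleCoeff α c) U := by
  rw [← plaqFn_negOne_mul]
  exact sub_le_plaqFn_scaleCoeff hf hα _

/-- **`Z_Λ({αc}) ≥ (1-α)^{|Λ|} > 0` for `0 ≤ α < 1` on the positivity domain `f_c ≥ 0`** (`|Λ|` = number of
plaquettes): every factor of the integrand (2.7) is at least `1 - α`. [cite: Tomboulis2007Confinement, §2 eqs. (2.7)–(2.8) and §3.2 eq. (3.12)] -/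
theorem torusZ_scaleCoeff_pos_of_plaqFn_nonneg {d L : ℕ} [NeZero L] {J : ℕ} {c : ℕ → ℝ}
    (hf : ∀ U : SU2, 0 ≤ plaqFn J c U) {α : ℝ} (hα0 : 0 ≤ α) (hα1 : α < 1) :
    0 < torusZ d L J (scaleCoeff α c) := by
  have hlow : (1 - α) ^ Fintype.card (Plaquette d L) ≤ torusZ d L J (scaleCoeff α c) := by
    unfold torusZ
    have hconst : ∫ _U : GaugeConfig d L SU2, (1 - α) ^ Fintype.card (Plaquette d L)
        ∂(Measure.pi fun _ : Edge d L => haarProbability SU2) = (1 - α) ^ Fintype.card (Plaquette d L) := by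
      simp
    rw [← hconst]
    refine integral_mono (integrable_const _)
      (integrable_of_continuous_config (continuous_finsetProd _ fun p _ =>
        (continuous_plaqFn' J _).comp (continuous_hol' p))) fun U => ?_
    dsimp only
    rw [← Finset.card_univ, ← Finset.prod_const]
    exact Finset.prod_le_prod (fun p _ => by linarith) fun p _ => sub_le_plaqFn_scaleCoeff hf hα0 _
  exact lt_of_lt_of_le (pow_pos (by linarith) _) hlow

/-- **`Z⁻_Λ({αc}) ≥ (1-α)^{|Λ|} > 0` for `0 ≤ α < 1` on the positivity domain `f_c ≥ 0`**, every twist set.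
[cite: Tomboulis2007Confinement, §4 eqs. (4.2)–(4.4) and §3.2 eq. (3.12)] -/
theorem torusZtw_scaleCoeff_pos_of_plaqFn_nonneg {d L : ℕ} [NeZero L] {J : ℕ} {c : ℕ → ℝ}
    (hf : ∀ U : SU2, 0 ≤ plaqFn J c U) {α : ℝ} (hα0 : 0 ≤ α) (hα1 : α < 1) (V : Finset (Plaquette d L)) :
    0 < torusZtw d L J (scaleCoeff α c) V := by
  classical
  have hlow : (1 - α) ^ Fintype.card (Plaquette d L) ≤ torusZtw d L J (scaleCoeff α c) V := by
    unfold torusZtw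
    have hconst : ∫ _U : GaugeConfig d L SU2, (1 - α) ^ Fintype.card (Plaquette d L)
        ∂(Measure.pi fun _ : Edge d L => haarProbability SU2) = (1 - α) ^ Fintype.card (Plaquette d L) := by
      simp
    rw [← hconst]
    refine integral_mono (integrable_const _)
      (integrable_of_continuous_config (continuous_finsetProd _ fun p _ => ?_)) fun U => ?_
    · by_cases hp : p ∈ V
      · simp only [hp, if_true]
        exact (continuous_plaqFnTwist' J _).comp (continuous_hol' p)
      · simp only [hp, if_false]
        exact (continuous_plaqFn' J _).comp (continuous_hol' p)
    · dsimp only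
      rw [← Finset.card_univ, ← Finset.prod_const]
      refine Finset.prod_le_prod (fun p _ => by linarith) fun p _ => ?_
      split_ifs
      · exact sub_le_plaqFnTwist_scaleCoeff hf hα0 _
      · exact sub_le_plaqFn_scaleCoeff hf hα0 _
  exact lt_of_lt_of_le (pow_pos (by linarith) _) hlow

/-- **(5.21) at `α = 1` on the positivity domain — `Z⁻_Λ/Z_Λ({c}) ≤ Z⁻_Λ/Z_Λ({αc})` for every `α ∈ (0,1)`** —
from the disputed inequality (5.16) (`Ineq515`: `∂_α ln Z⁻ ≤ ∂_α ln Z` on `(0,1)`) and `f_c ≥ 0` ALONE: no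
positivity proviso at the endpoint (Tomboulis: "Setting `α` equal to `1` in (5.21) … gives (5.22)").  Proof: on
`[α, s]`, `s < 1`, both partition functions are positive (previous theorems) polynomials in the parameter, so
`ln Z⁻ - ln Z` is non-increasing there by the mean value theorem; let `s ↑ 1` using polynomial continuity when
`Z({c}) > 0`, while a vanishing `Z({c})` makes the left side the junk value `0 ≤ Z⁻/Z({αc})`.
[cite: Tomboulis2007Confinement, §5.2 eqs. (5.16), (5.21)–(5.22)] -/
theorem vortexRatio_le_of_ineq515_of_plaqFn_nonneg {d L : ℕ} [NeZero L] (J : ℕ) (c : ℕ → ℝ)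
    (V : Finset (Plaquette d L)) (hf : ∀ U : SU2, 0 ≤ plaqFn J c U) (h515 : Ineq515 d L J c V)
    {a : ℝ} (ha0 : 0 < a) (ha1 : a < 1) :
    vortexRatio d L J c V ≤ vortexRatio d L J (scaleCoeff a c) V := by
  obtain ⟨PZ, hPZ⟩ := exists_polynomial_torusZ_scaleCoeff d L J c
  obtain ⟨PW, hPW⟩ := exists_polynomial_torusZtw_scaleCoeff d L J c V
  have hposZ : ∀ α ∈ Set.Ico (0 : ℝ) 1, 0 < PZ.eval α := fun α hα => by
    rw [← hPZ]; exact torusZ_scaleCoeff_pos_of_plaqFn_nonneg hf hα.1 hα.2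
  have hposW : ∀ α ∈ Set.Ico (0 : ℝ) 1, 0 < PW.eval α := fun α hα => by
    rw [← hPW]; exact torusZtw_scaleCoeff_pos_of_plaqFn_nonneg hf hα.1 hα.2 V
  set g : ℝ → ℝ := fun α => Real.log (PW.eval α) - Real.log (PZ.eval α) with hg
  have hW_fun : (fun a => Real.log (torusZtw d L J (scaleCoeff a c) V)) = fun a => Real.log (PW.eval a) :=
    funext fun a => by rw [hPW]
  have hZ_fun : (fun a => Real.log (torusZ d L J (scaleCoeff a c))) = fun a => Real.log (PZ.eval a) :=
    funext fun a => by rw [hPZ]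
  have hdW : ∀ α ∈ Set.Ico (0 : ℝ) 1, DifferentiableAt ℝ (fun a => Real.log (PW.eval a)) α :=
    fun α hα => (PW.differentiableAt).log (hposW α hα).ne'
  have hdZ : ∀ α ∈ Set.Ico (0 : ℝ) 1, DifferentiableAt ℝ (fun a => Real.log (PZ.eval a)) α :=
    fun α hα => (PZ.differentiableAt).log (hposZ α hα).ne'
  -- `g` is non-increasing on every `[0, s]`, `s < 1`
  have hg_anti : ∀ s, s < 1 → AntitoneOn g (Set.Icc (0 : ℝ) s) := by
    intro s hs
    have hsub : Set.Icc (0 : ℝ) s ⊆ Set.Ico (0 : ℝ) 1 := fun x hx => ⟨hx.1, lt_of_le_of_lt hx.2 hs⟩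
    refine antitoneOn_of_deriv_nonpos (convex_Icc 0 s) ?_ ?_ ?_
    · exact fun α hα => ((hdW α (hsub hα)).sub (hdZ α (hsub hα))).continuousAt.continuousWithinAt
    · rw [interior_Icc]
      exact fun α hα => ((hdW α (hsub (Set.Ioo_subset_Icc_self hα))).sub
        (hdZ α (hsub (Set.Ioo_subset_Icc_self hα)))).differentiableWithinAt
    · rw [interior_Icc]
      intro α hα
      have hα' : α ∈ Set.Ico (0 : ℝ) 1 := hsub (Set.Ioo_subset_Icc_self hα)
      have h := h515 α ⟨hα.1, lt_of_lt_of_le hα.2 hs.le⟩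
      rw [hW_fun, hZ_fun] at h
      rw [hg, deriv_fun_sub (hdW α hα') (hdZ α hα')]
      linarith
  -- the ratio on `[a, 1)` is below its value at `a`
  have hratio : ∀ α ∈ Set.Ico (0 : ℝ) 1, vortexRatio d L J (scaleCoeff α c) V = Real.exp (g α) := by
    intro α hα
    unfold vortexRatio
    rw [hPW, hPZ, hg]
    dsimp only
    rw [Real.exp_sub, Real.exp_log (hposW α hα), Real.exp_log (hposZ α hα)]
  have hle : ∀ s ∈ Set.Ico a 1, PW.eval s / PZ.eval s ≤ vortexRatio d L J (scaleCoeff a c) V := by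
    intro s hs
    have hs' : s ∈ Set.Ico (0 : ℝ) 1 := ⟨ha0.le.trans hs.1, hs.2⟩
    have h1 : vortexRatio d L J (scaleCoeff s c) V ≤ vortexRatio d L J (scaleCoeff a c) V := by
      rw [hratio s hs', hratio a ⟨ha0.le, ha1⟩]
      exact Real.exp_le_exp.2 (hg_anti s hs.2 ⟨ha0.le, hs.1⟩ ⟨hs'.1, le_rfl⟩ hs.1)
    unfold vortexRatio at h1 ⊢
    rw [hPW, hPZ] at h1
    exact h1
  -- the endpoint `α = 1`
  have h1c : scaleCoeff 1 c = c := funext fun k => one_mul _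
  have hZ1 : torusZ d L J c = PZ.eval 1 := by rw [← hPZ, h1c]
  have hW1 : torusZtw d L J c V = PW.eval 1 := by rw [← hPW, h1c]
  unfold vortexRatio
  rw [hZ1, hW1]
  by_cases hZ0 : PZ.eval 1 = 0
  · rw [hZ0, div_zero, hPW, hPZ]
    exact (div_pos (hposW a ⟨ha0.le, ha1⟩) (hposZ a ⟨ha0.le, ha1⟩)).le
  · have htend : Tendsto (fun s => PW.eval s / PZ.eval s) (𝓝[<] (1 : ℝ)) (𝓝 (PW.eval 1 / PZ.eval 1)) :=
      ((PW.continuous.tendsto 1).div (PZ.continuous.tendsto 1) hZ0).mono_left nhdsWithin_le_nhds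
    refine le_of_tendsto htend ?_
    filter_upwards [Ioo_mem_nhdsLT ha1] with s hs
    exact hle s ⟨hs.1.le, hs.2⟩

/-- **Prop. V.2 (lower half, (5.22)) as an implication, PROVED on the positivity domain**: (H_V2) `PropV2Claim`
holds at level `n` whenever the level-`n` plaquette function is non-negative, `f_{c^U(n)} ≥ 0` — no positivity
proviso on the partition functions is left. [cite: Tomboulis2007Confinement, §5.2 Prop. V.2 eqs. (5.21)–(5.22)] -/
theorem propV2Claim_of_plaqFn_nonneg {d : ℕ} (L b J n : ℕ) [NeZero L] [NeZero b] (r : ℝ) {i j : Fin d}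
    (hij : i < j) (c : ℕ → ℝ)
    (hf : ∀ U : SU2, 0 ≤ plaqFn (cutoffIter d J b n) (upperCoeffIter d J c b r n) U) :
    PropV2Claim d L b J n r hij c := by
  intro hCI h516
  obtain ⟨a, ha, hEq⟩ := hCI
  unfold MKTIneq
  rw [hEq]
  exact vortexRatio_le_of_ineq515_of_plaqFn_nonneg _ _ _ hf h516 ha.1 ha.2

/-- **(H_pos) on the positivity domain**: if `c` is admissible (2.8), `r ≥ 0` and the decimated plaquette functions
stay non-negative, `f(U; m) ≥ 0` for all `m`, then every column vector `c^U(m)` is admissible ((2.28) iterated: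
`coeffAdmissible_mkCoeff_of_nonneg` at each step, positivity of `c^U(m)` from `upperCoeffIter_nonneg`).
[cite: Tomboulis2007Confinement, §2.2 eq. (2.28) and §3.4 scheme (3.38)] -/
theorem coeffAdmissible_upperCoeffIter_of_plaqFn_nonneg {d J : ℕ} {c : ℕ → ℝ} (hc : CoeffAdmissible c)
    (b : ℕ) {r : ℝ} (hr : 0 ≤ r)
    (hf : ∀ m (U : SU2), 0 ≤ plaqFn (cutoffIter d J b m) (upperCoeffIter d J c b r m) U) :
    ∀ m, CoeffAdmissible (upperCoeffIter d J c b r m)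
  | 0 => hc
  | m + 1 => coeffAdmissible_mkCoeff_of_nonneg
      (upperCoeffIter_nonneg (fun n hn => (hc n hn).1) b r m) (hf m) _ _ hr

/-- **«(5.16) ⟹ confinement» ON THE POSITIVITY DOMAIN — (H_pos), (H_V1), (H_V2) all discharged.**  For initial
coefficients `0 ≤ c_j ≤ 1` (2.8), exponent parameter `r ≥ 0`, and a column whose decimated plaquette functions stay
non-negative, `f(U; m) ≥ 0` for every `m` (arXiv:0707.2179 (2.23)–(2.25), §3.1): IF (H_flow) the column flows to
strong coupling in norm (3.43), (H_sc) `d` has a strong-coupling regime for the twist (§6.2), (H_C) Appendix C's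
claim holds at every level/side/plane, and (H_516) the disputed inequality (5.16) holds at every level on every
coarse ray, THEN every plane has a level `n` with the electric-flux area law along the sides `b^n L`.  The named
hypotheses left are the positivity of the decimated plaquette functions and exactly the links contested by
Ito–Seiler (plus the flow for `r < 1` and the §6.2 input); Props. V.1 and V.2 are theorems
(`propV1Claim_of_admissible`, `propV2Claim_of_plaqFn_nonneg`).
[cite: Tomboulis2007Confinement, Abstract, §2.2 eq. (2.28), §5 Props. V.1–V.2, §6.2, App. C]
[cite: ItoSeiler2009Critical, §§2, 4(b), 5] -/
theorem electricFluxAreaLawAlong_of_chain_on_posDomain (d J : ℕ) (c : ℕ → ℝ) (b : ℕ) [NeZero b] (r : ℝ)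
    (hc : CoeffAdmissible c) (hr : 0 ≤ r)
    (hf : ∀ m (U : SU2), 0 ≤ plaqFn (cutoffIter d J b m) (upperCoeffIter d J c b r m) U)
    (hFlow : UpperFlowInNorm d J c b r) (hSC : StrongCouplingRegime d)
    (hC : ∀ (n L : ℕ) [NeZero L] (i j : Fin d) (hij : i < j), 1 ≤ n → 2 ≤ L → AppendixCClaim d L b J n r hij c)
    (h516 : ∀ (n L : ℕ) [NeZero L] (i j : Fin d) (hij : i < j), 1 ≤ n → 2 ≤ L → Ineq516AtLevel d L b J n r hij c) :
    ∀ (i j : Fin d) (hij : i < j), ∃ n : ℕ, ElectricFluxAreaLawAlong d b n J c hij :=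
  electricFluxAreaLawAlong_of_chain d J c b r (coeffAdmissible_upperCoeffIter_of_plaqFn_nonneg hc b hr hf)
    hFlow hSC hC (fun n L _ _ _ hij _ _ => propV2Claim_of_plaqFn_nonneg L b J n r hij c (hf n)) h516

end Tomboulis2007

end Literature.MathematicalPhysics.QuantumFieldTheory

end
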